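import Summits.BirchSwinnertonDyer.BirchSwinnertonDyer.Theorems.PrintX11aUpperNonSurjFiveCartanDescent
import Summits.BirchSwinnertonDyer.BirchSwinnertonDyer.Theses.PrintX11a
import HarnessLib

/-!
# Route `PrintX11a`, crux U5 = `Theses.PrintX11a.UpperNonSurjFive` (item stmt-BirchSwinnertonDyer-20614), line of record
# «gl1cartan5»: the crux BY NAME from the landed SECTOR and the two residual sectors — PLANNER TURNKEY for a glued split, with
# exactness (the split is lossless)

Cell `bsd-print-x11a`, LEAD `cruxlead-stmt-BirchSwinnertonDyer-20614` g2.  State of the line after g0 (skeleton rev 7, sha16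
9dd2587d87d5892a): the lever D is the landed theorem `GL1Cartan.stub_cartanDescent` (p659482) and the SECTOR of U5 it opens is the
landed theorem `GL1Cartan.upperNonSurjFive_on_selmerTrivialMainLocus` (same file: on the main locus, a Cartan descent datum with
trivial GL₁ Selmer group gives `MissingUpperBoundAt W p`, CONDITIONALLY on three named print facts — Gross–Zagier–Kolyvagin,
modularity, Mazur's Manin-constant theorem at odd `p`).  What U5 still lacks is exactly its restriction to the complement of that
sector, in two pieces: R₁ (OFF the main locus: image `5S4`, real Cartan field, split multiplicative `p`, a split or Cartan-inert
multiplicative `ℓ ≠ p`) and R₂ (ON the main locus with every datum GL₁-obstructed; by the line's corrected reach these are the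
main-locus pairs with `p ∣ #Ш(E)` — a same-wall research residual, no GL₁ road leads into it).  Both are OPEN research statements
(U5 verbatim on sub-loci) and live as sorried stubs `stub_offLocus` / `stub_gl1Obstructed` in the crux workfile only.

THIS FILE (theorems only; no definition, no named fact minted, no `sorry`) is the bookkeeping a planner's glued split of item 20614
would be closed by, in both shapes, plus the converse directions showing the split loses nothing:

* §1 `GL1Cartan.upperNonSurjFive_of_sector_of_residuals : SECTOR → R₁ → R₂ → UpperNonSurjFive` — FACT-FREE glue by cases
  (children = the sector statement verbatim + the two residuals verbatim; the sector child is then served by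
  `upperNonSurjFive_on_selmerTrivialMainLocus`, conditional on the three prints).
* §1 `GL1Cartan.upperNonSurjFive_of_facts_of_residuals : GZK → modularity → Mazur → R₁ → R₂ → UpperNonSurjFive` — the same with the
  sector inlined (children = three named-fact binders, two of which are the route's existing items `RankEqAnalyticRankLeOne` (19921) and
  `NewformOfEllipticCurve` (19382), + the two residuals).
* §2 `GL1Cartan.sector_of_upperNonSurjFive`, `offLocus_of_upperNonSurjFive`, `gl1Obstructed_of_upperNonSurjFive` — U5 gives each child
  back (they are restrictions), and `GL1Cartan.upperNonSurjFive_iff_sector_and_residuals : UpperNonSurjFive ↔ SECTOR ∧ R₁ ∧ R₂` —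
  EXACTNESS of the split, fact-free.

HONEST FRAMING.  Item 20614 is NOT closed by this file (its own signature is proved only from hypotheses that include the two open
residuals; the gate records `proof.conditional`, credits nothing).  The leaf `ClassX11a` is not closed; no statement of the summit
is proved; BSD is not proved by any of this and nothing here bounds a non-trivial `Ш`.  «beyond-print theorem: NO» (re-plumbing).

References: [Miller2011LMS] Def. 1.1 (shape of `MissingUpperBoundAt`); [MazurRubin2004] Def. 2.1.1 (Selmer structures);
[Serre1972] §2.8 (Cartan normalisers); tree `Theorems/PrintX11aUpperNonSurjFiveCartanDescent.lean` (p659482),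
`Theorems/PrintX11aGL1CartanDefs.lean` (p656368/p657268), `Cruxes/UpperNonSurjFive/Lines/gl1cartan5.lean` (rev 7).
-/

-- justified: the file namespace `Summit.BirchSwinnertonDyer.BirchSwinnertonDyer.Theorems.GL1Cartan` repeats the sub-problem segment by the D-0017 layout
set_option linter.dupNamespace false
set_option autoImplicit false

noncomputable section

open scoped Classical NumberField

open WeierstrassCurve
  Literature.NumberTheory.EllipticCurves
  Literature.NumberTheory.EllipticCurves.Rank1Residual
  Literature.NumberTheory.EllipticCurves.Rank1Residual.Typed
  Literature.NumberTheory.SerreUniformity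
  Summit.BirchSwinnertonDyer.Rank1Residual
  Summit.BirchSwinnertonDyer.BirchSwinnertonDyer.Theses

namespace Summit.BirchSwinnertonDyer.BirchSwinnertonDyer.Theorems.GL1Cartan

/-! ## §1 The crux BY NAME from the sector and the two residual sectors (glue, both shapes) -/

/-- **Glue, shape A (fact-free): SECTOR → R₁ → R₂ → U5.**  If U5's conclusion holds (i) on the main locus whenever some Cartan descent
datum has trivial GL₁ Selmer group (the SECTOR — served by `upperNonSurjFive_on_selmerTrivialMainLocus` modulo three prints),
(ii) off the main locus (R₁) and (iii) on the main locus when every datum is GL₁-obstructed (R₂), then U5 =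
`Theses.PrintX11a.UpperNonSurjFive` holds: a case split, nothing else.  The three hypotheses are the verbatim statements of the
would-be children; none of them is discharged here. [cite: Miller2011LMS, Def. 1.1 (shape of the halves)] -/
theorem upperNonSurjFive_of_sector_of_residuals
    (hS : ∀ (W : WeierstrassCurve ℚ) [W.IsElliptic] [W.IsGloballyMinimal] (p : ℕ) [Fact p.Prime],
      ClassX11a W p → ¬ Surj W p → 5 ≤ p → MainLocus W p → (∃ 𝒟 : CartanDatum W p, 𝒟.SelmerTrivial) →
      MissingUpperBoundAt W p)
    (hR₁ : ∀ (W : WeierstrassCurve ℚ) [W.IsElliptic] [W.IsGloballyMinimal] (p : ℕ) [Fact p.Prime],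
      ClassX11a W p → ¬ Surj W p → 5 ≤ p → ¬ MainLocus W p → MissingUpperBoundAt W p)
    (hR₂ : ∀ (W : WeierstrassCurve ℚ) [W.IsElliptic] [W.IsGloballyMinimal] (p : ℕ) [Fact p.Prime],
      ClassX11a W p → ¬ Surj W p → 5 ≤ p → MainLocus W p → (∀ 𝒟 : CartanDatum W p, ¬ 𝒟.SelmerTrivial) →
      MissingUpperBoundAt W p) :
    PrintX11a.UpperNonSurjFive := by
  intro W _ _ p _ hX hns hp5
  by_cases hL : MainLocus W p
  · by_cases hT : ∃ 𝒟 : CartanDatum W p, 𝒟.SelmerTrivial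
    · exact hS W p hX hns hp5 hL hT
    · exact hR₂ W p hX hns hp5 hL (fun 𝒟 h𝒟 => hT ⟨𝒟, h𝒟⟩)
  · exact hR₁ W p hX hns hp5 hL

/-- **Glue, shape B (sector inlined): GZK → modularity → Mazur → R₁ → R₂ → U5.**  The sector hypothesis of shape A is discharged by
the landed sector theorem `upperNonSurjFive_on_selmerTrivialMainLocus` (line gl1cartan5: Cartan descent `stub_cartanDescent` +
`p`-integrality of `#Ш_an` via `shaAnIntegral_of_mazur` + the `#Sel_p ≤ 1` door), which is conditional on the three named print
facts `rank_eq_analyticRank_of_analyticRank_le_one` (Gross–Zagier–Kolyvagin; route item `RankEqAnalyticRankLeOne`),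
`exists_isNewformOf` (modularity; route item `NewformOfEllipticCurve`) and `mazur_not_dvd_maninConstant_of_odd` (Mazur 1978
Cor. 4.1); so U5 holds granted those three prints and the two residual sectors.  CONDITIONAL (credits nothing): R₁ and R₂ are open.
[cite: Mazur1978, Cor. 4.1] [cite: Wuthrich2014, Thm. 1 and Cor. 7] [cite: MazurRubin2004, Def. 2.1.1] -/
theorem upperNonSurjFive_of_facts_of_residuals
    (hGZK : rank_eq_analyticRank_of_analyticRank_le_one)
    (hnf : Literature.NumberTheory.EllipticCurves.ModularForms.exists_isNewformOf)
    (hMz : Literature.NumberTheory.EllipticCurves.ModularForms.mazur_not_dvd_maninConstant_of_odd)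
    (hR₁ : ∀ (W : WeierstrassCurve ℚ) [W.IsElliptic] [W.IsGloballyMinimal] (p : ℕ) [Fact p.Prime],
      ClassX11a W p → ¬ Surj W p → 5 ≤ p → ¬ MainLocus W p → MissingUpperBoundAt W p)
    (hR₂ : ∀ (W : WeierstrassCurve ℚ) [W.IsElliptic] [W.IsGloballyMinimal] (p : ℕ) [Fact p.Prime],
      ClassX11a W p → ¬ Surj W p → 5 ≤ p → MainLocus W p → (∀ 𝒟 : CartanDatum W p, ¬ 𝒟.SelmerTrivial) →
      MissingUpperBoundAt W p) :
    PrintX11a.UpperNonSurjFive :=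
  upperNonSurjFive_of_sector_of_residuals (upperNonSurjFive_on_selmerTrivialMainLocus hGZK hnf hMz) hR₁ hR₂

/-! ## §2 Exactness: the split loses nothing -/

/-- U5 gives the sector statement back (it is U5 restricted to a sub-locus). [cite: Miller2011LMS, Def. 1.1] -/
theorem sector_of_upperNonSurjFive (h : PrintX11a.UpperNonSurjFive) :
    ∀ (W : WeierstrassCurve ℚ) [W.IsElliptic] [W.IsGloballyMinimal] (p : ℕ) [Fact p.Prime],
      ClassX11a W p → ¬ Surj W p → 5 ≤ p → MainLocus W p → (∃ 𝒟 : CartanDatum W p, 𝒟.SelmerTrivial) →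
      MissingUpperBoundAt W p :=
  fun W _ _ p _ hX hns hp5 _ _ => h W p hX hns hp5

/-- U5 gives the off-locus residual R₁ back (restriction). [cite: Miller2011LMS, Def. 1.1] -/
theorem offLocus_of_upperNonSurjFive (h : PrintX11a.UpperNonSurjFive) :
    ∀ (W : WeierstrassCurve ℚ) [W.IsElliptic] [W.IsGloballyMinimal] (p : ℕ) [Fact p.Prime],
      ClassX11a W p → ¬ Surj W p → 5 ≤ p → ¬ MainLocus W p → MissingUpperBoundAt W p :=
  fun W _ _ p _ hX hns hp5 _ => h W p hX hns hp5

/-- U5 gives the GL₁-obstructed residual R₂ back (restriction). [cite: Miller2011LMS, Def. 1.1] -/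
theorem gl1Obstructed_of_upperNonSurjFive (h : PrintX11a.UpperNonSurjFive) :
    ∀ (W : WeierstrassCurve ℚ) [W.IsElliptic] [W.IsGloballyMinimal] (p : ℕ) [Fact p.Prime],
      ClassX11a W p → ¬ Surj W p → 5 ≤ p → MainLocus W p → (∀ 𝒟 : CartanDatum W p, ¬ 𝒟.SelmerTrivial) →
      MissingUpperBoundAt W p :=
  fun W _ _ p _ hX hns hp5 _ _ => h W p hX hns hp5

/-- **Exactness of the split (fact-free): U5 ↔ SECTOR ∧ R₁ ∧ R₂.**  The crux `Theses.PrintX11a.UpperNonSurjFive` is EQUIVALENT to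
the conjunction of the sector statement and the two residual statements of line gl1cartan5 — so a glued split of item 20614 into
these three children (or into three print binders + R₁ + R₂, shape B) is lossless. [cite: Miller2011LMS, Def. 1.1 (shape of the halves)] -/
theorem upperNonSurjFive_iff_sector_and_residuals :
    PrintX11a.UpperNonSurjFive ↔
      ((∀ (W : WeierstrassCurve ℚ) [W.IsElliptic] [W.IsGloballyMinimal] (p : ℕ) [Fact p.Prime],
          ClassX11a W p → ¬ Surj W p → 5 ≤ p → MainLocus W p → (∃ 𝒟 : CartanDatum W p, 𝒟.SelmerTrivial) →
          MissingUpperBoundAt W p) ∧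
        (∀ (W : WeierstrassCurve ℚ) [W.IsElliptic] [W.IsGloballyMinimal] (p : ℕ) [Fact p.Prime],
          ClassX11a W p → ¬ Surj W p → 5 ≤ p → ¬ MainLocus W p → MissingUpperBoundAt W p) ∧
        (∀ (W : WeierstrassCurve ℚ) [W.IsElliptic] [W.IsGloballyMinimal] (p : ℕ) [Fact p.Prime],
          ClassX11a W p → ¬ Surj W p → 5 ≤ p → MainLocus W p → (∀ 𝒟 : CartanDatum W p, ¬ 𝒟.SelmerTrivial) →
          MissingUpperBoundAt W p)) :=
  ⟨fun h => ⟨sector_of_upperNonSurjFive h, offLocus_of_upperNonSurjFive h, gl1Obstructed_of_upperNonSurjFive h⟩,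
    fun h => upperNonSurjFive_of_sector_of_residuals h.1 h.2.1 h.2.2⟩

end Summit.BirchSwinnertonDyer.BirchSwinnertonDyer.Theorems.GL1Cartan

end
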